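import Literature.NumberTheory.Automorphic.ArchRankinSelbergTestVector

/-!
# A complex polynomial-times-Gaussian is a combination of four NON-NEGATIVE ones

Route `IrreducibilityBySelfDuality`, crux `PairLBoundaryJS` (stmt-Langlands-13622), line `Sketch`
(lead c2): glue between the archimedean test-vector fact `HumphriesJo2024_archRankinSelberg_testVector`
(`ArchRankinSelbergTestVector`; its test function `Φ_∞` is a COMPLEX polynomial times a Gaussian) and
the tree's global Rankin–Selberg theorems, which take REAL NON-NEGATIVE test functions
(`stub_global_pair_gen`, `stub_global_pair_twisted_gen`): since the local integrals are linear in `Φ`,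
it suffices to write `Φ_∞ = Φ₁ - Φ₂ + i (Φ₃ - Φ₄)` with `Φ_k ≥ 0` again polynomial-times-Gaussian.

* `MvPolynomial.norm_eval_ofReal_le` — `‖q(x)‖ ≤ M (1 + ∑ xᵢ²)^d` for a complex polynomial at real
  points (`M = ∑ ‖coeff‖`, `d` the total degree);
* `exists_nonneg_decomposition_of_isArchPolyGaussian` (**main**).
-/

noncomputable section

-- `Summit.Langlands.Langlands.…` (summit = sub-problem name, D-0017 layout) trips `dupNamespace`
set_option linter.dupNamespace false

open scoped ComplexConjugate
open NumberField NumberField.mixedEmbedding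

namespace Summit.Langlands.Langlands.Theorems

/-! ### Polynomial growth of a complex polynomial at real points -/

/-- `|t| ^ k ≤ (1 + B) ^ k` whenever `t² ≤ B`. -/
theorem abs_pow_le_one_add_pow {t B : ℝ} (ht : t ^ 2 ≤ B) (k : ℕ) :
    |t| ^ k ≤ (1 + B) ^ k := by
  refine pow_le_pow_left₀ (abs_nonneg t) ?_ k
  have h1 : |t| ≤ 1 + t ^ 2 := by
    rcases le_or_gt |t| 1 with h | h
    · linarith [sq_nonneg t]
    · have : |t| ≤ |t| ^ 2 := by
        calc |t| = |t| * 1 := (mul_one _).symm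
          _ ≤ |t| * |t| := mul_le_mul_of_nonneg_left h.le (abs_nonneg t)
          _ = |t| ^ 2 := (sq _).symm
      rw [sq_abs] at this
      linarith
  linarith

/-- **A complex polynomial grows polynomially at real points**: for `q ∈ ℂ[X_1, …, X_N]`,
`‖q(x)‖ ≤ M · (1 + ∑ᵢ xᵢ²)^d` for all real `x`, with `M = ∑_m ‖coeff_m q‖ ≥ 0` and `d` the total
degree. -/
theorem MvPolynomial.norm_eval_ofReal_le {N : ℕ} (q : MvPolynomial (Fin N) ℂ) :
    ∃ (d : ℕ) (M : ℝ), 0 ≤ M ∧ ∀ x : Fin N → ℝ,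
      ‖MvPolynomial.eval (fun i => (x i : ℂ)) q‖ ≤ M * (1 + ∑ i, x i ^ 2) ^ d := by
  classical
  refine ⟨q.totalDegree, ∑ m ∈ q.support, ‖q.coeff m‖, Finset.sum_nonneg fun _ _ => norm_nonneg _,
    fun x => ?_⟩
  set B : ℝ := ∑ i, x i ^ 2 with hB
  have hB0 : 0 ≤ B := Finset.sum_nonneg fun i _ => sq_nonneg (x i)
  have hsq : ∀ i, x i ^ 2 ≤ B := fun i =>
    Finset.single_le_sum (f := fun j => x j ^ 2) (fun j _ => sq_nonneg (x j)) (Finset.mem_univ i)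
  have h1B : 1 ≤ 1 + B := by linarith [hB0]
  rw [MvPolynomial.eval_eq']
  refine (norm_sum_le _ _).trans ?_
  rw [Finset.sum_mul]
  refine Finset.sum_le_sum fun m hm => ?_
  rw [norm_mul, norm_prod]
  refine mul_le_mul_of_nonneg_left ?_ (norm_nonneg _)
  -- `∏ᵢ |xᵢ|^{mᵢ} ≤ (1 + B)^{∑ mᵢ} ≤ (1 + B)^d`
  have hprod : ∏ i, ‖((x i : ℂ)) ^ (m i)‖ ≤ ∏ i, (1 + B) ^ (m i) := by
    refine Finset.prod_le_prod (fun i _ => norm_nonneg _) fun i _ => ?_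
    rw [norm_pow, Complex.norm_real, Real.norm_eq_abs]
    exact abs_pow_le_one_add_pow (hsq i) (m i)
  refine hprod.trans ?_
  rw [Finset.prod_pow_eq_pow_sum]
  refine pow_le_pow_right₀ h1B ?_
  have h := MvPolynomial.le_totalDegree hm
  simpa [Finsupp.sum_fintype] using h

/-- At a real point, the conjugate-coefficient polynomial evaluates to the conjugate value. -/
theorem eval_map_conj_ofReal {N : ℕ} (q : MvPolynomial (Fin N) ℂ) (x : Fin N → ℝ) :
    MvPolynomial.eval (fun i => (x i : ℂ)) (MvPolynomial.map (starRingEnd ℂ) q) =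
      conj (MvPolynomial.eval (fun i => (x i : ℂ)) q) := by
  rw [MvPolynomial.eval_map, ← MvPolynomial.eval₂_id, MvPolynomial.eval₂_comp_left (starRingEnd ℂ)]
  congr 1
  funext i
  exact (Complex.conj_ofReal (x i)).symm

/-- At a real point, `(1 + ∑ Xᵢ²)^d` evaluates to `(1 + ∑ xᵢ²)^d`. -/
theorem eval_one_add_sum_sq_pow {N : ℕ} (d : ℕ) (x : Fin N → ℝ) :
    MvPolynomial.eval (fun i => (x i : ℂ)) ((1 + ∑ i, MvPolynomial.X i ^ 2) ^ d : MvPolynomial (Fin N) ℂ) =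
      (((1 + ∑ i, x i ^ 2) ^ d : ℝ) : ℂ) := by
  simp only [map_pow, map_add, map_one, map_sum, MvPolynomial.eval_X]
  push_cast
  rfl

/-! ### The decomposition -/

variable {n : ℕ} {K : Type} [Field K] [NumberField K]

omit [NumberField K] in
open Literature.NumberTheory.Automorphic in
/-- **A complex polynomial-times-Gaussian is `Φ₁ - Φ₂ + i (Φ₃ - Φ₄)` with NON-NEGATIVE real
polynomial-times-Gaussians `Φ_k`.** If `Φ_∞(z) = q(L(x)) e^{-‖T x‖²}` (`IsArchPolyGaussian`), then
with `M (1 + ∑ Lᵢ(x)²)^d ≥ ‖q(L(x))‖` (`MvPolynomial.norm_eval_ofReal_le`):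
`Φ₁ = (re q + M P) G`, `Φ₂ = Φ₄ = M P G`, `Φ₃ = (im q + M P) G`, `P = (1 + ∑ Xᵢ²)^d`, `G` the
Gaussian; each is real, `≥ 0`, and again of the class (the polynomials `(q + q̄)/2 + M P`,
`(q - q̄)/(2i) + M P`, `M P` have complex coefficients and real values at real points). -/
theorem exists_nonneg_decomposition_of_isArchPolyGaussian :
    ∀ {Φ : (Fin n → InfiniteAdeleRing K) → ℂ}, IsArchPolyGaussian n K Φ →
    ∃ Φ₁ Φ₂ Φ₃ Φ₄ : (Fin n → InfiniteAdeleRing K) → ℝ,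
      (∀ z, 0 ≤ Φ₁ z) ∧ (∀ z, 0 ≤ Φ₂ z) ∧ (∀ z, 0 ≤ Φ₃ z) ∧ (∀ z, 0 ≤ Φ₄ z) ∧
      IsArchPolyGaussian n K (fun z => (Φ₁ z : ℂ)) ∧ IsArchPolyGaussian n K (fun z => (Φ₂ z : ℂ)) ∧
      IsArchPolyGaussian n K (fun z => (Φ₃ z : ℂ)) ∧ IsArchPolyGaussian n K (fun z => (Φ₄ z : ℂ)) ∧
      ∀ z, Φ z = (Φ₁ z : ℂ) - Φ₂ z + Complex.I * ((Φ₃ z : ℂ) - Φ₄ z) := by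
  intro Φ h
  classical
  obtain ⟨N, L, q, T, hΦ⟩ := h
  obtain ⟨d, M, hM, hq⟩ := MvPolynomial.norm_eval_ofReal_le q
  -- real coordinates of `z`, the real point `y = L(x)`, the Gaussian and the majorant `M (1 + ∑ yᵢ²)^d`
  set X : (Fin n → InfiniteAdeleRing K) → (Fin n → mixedSpace K) :=
    fun z j => InfiniteAdeleRing.ringEquiv_mixedSpace K (z j) with hX
  set y : (Fin n → InfiniteAdeleRing K) → Fin N → ℝ := fun z i => L i (X z) with hy
  set G : (Fin n → InfiniteAdeleRing K) → ℝ := fun z => Real.exp (-‖T (X z)‖ ^ 2) with hG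
  set R : (Fin n → InfiniteAdeleRing K) → ℝ := fun z => M * (1 + ∑ i, y z i ^ 2) ^ d with hR
  have hG0 : ∀ z, 0 ≤ G z := fun z => (Real.exp_pos _).le
  have hR0 : ∀ z, 0 ≤ R z := fun z =>
    mul_nonneg hM (pow_nonneg (by linarith [Finset.sum_nonneg fun i (_ : i ∈ Finset.univ) => sq_nonneg (y z i)]) _)
  have hqz : ∀ z, ‖MvPolynomial.eval (fun i => (y z i : ℂ)) q‖ ≤ R z := fun z => hq (y z)
  have hΦz : ∀ z, Φ z = MvPolynomial.eval (fun i => (y z i : ℂ)) q * (G z : ℂ) := fun z => hΦ z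
  -- the four functions
  refine ⟨fun z => ((MvPolynomial.eval (fun i => (y z i : ℂ)) q).re + R z) * G z, fun z => R z * G z,
    fun z => ((MvPolynomial.eval (fun i => (y z i : ℂ)) q).im + R z) * G z, fun z => R z * G z,
    ?_, ?_, ?_, ?_, ?_, ?_, ?_, ?_, ?_⟩
  · intro z
    refine mul_nonneg ?_ (hG0 z)
    have := (Complex.abs_re_le_norm _).trans (hqz z)
    linarith [neg_abs_le (MvPolynomial.eval (fun i => (y z i : ℂ)) q).re]
  · exact fun z => mul_nonneg (hR0 z) (hG0 z)
  · intro z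
    refine mul_nonneg ?_ (hG0 z)
    have := (Complex.abs_im_le_norm _).trans (hqz z)
    linarith [neg_abs_le (MvPolynomial.eval (fun i => (y z i : ℂ)) q).im]
  · exact fun z => mul_nonneg (hR0 z) (hG0 z)
  -- the class: the polynomials `(q + q̄)/2 + M P`, `M P`, `(q - q̄)/(2 i) + M P`
  · exact ⟨N, L, MvPolynomial.C (1 / 2 : ℂ) * (q + MvPolynomial.map (starRingEnd ℂ) q) +
      MvPolynomial.C (M : ℂ) * (1 + ∑ i, MvPolynomial.X i ^ 2) ^ d, T, fun z => by
      change (((((MvPolynomial.eval (fun i => (y z i : ℂ)) q).re + R z) * G z : ℝ) : ℂ)) = _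
      rw [map_add, map_mul, map_mul, MvPolynomial.eval_C, MvPolynomial.eval_C, map_add,
        eval_map_conj_ofReal, Complex.add_conj, eval_one_add_sum_sq_pow]
      simp only [hR, hG, hy, hX]
      push_cast
      ring⟩
  · exact ⟨N, L, MvPolynomial.C (M : ℂ) * (1 + ∑ i, MvPolynomial.X i ^ 2) ^ d, T, fun z => by
      change (((R z * G z : ℝ) : ℂ)) = _
      rw [map_mul, MvPolynomial.eval_C, eval_one_add_sum_sq_pow]
      simp only [hR, hG, hy, hX]
      push_cast
      ring⟩
  · exact ⟨N, L, MvPolynomial.C (-Complex.I / 2) * (q - MvPolynomial.map (starRingEnd ℂ) q) +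
      MvPolynomial.C (M : ℂ) * (1 + ∑ i, MvPolynomial.X i ^ 2) ^ d, T, fun z => by
      change (((((MvPolynomial.eval (fun i => (y z i : ℂ)) q).im + R z) * G z : ℝ) : ℂ)) = _
      rw [map_add, map_mul, map_mul, MvPolynomial.eval_C, MvPolynomial.eval_C, map_sub,
        eval_map_conj_ofReal, Complex.sub_conj, eval_one_add_sum_sq_pow]
      simp only [hR, hG, hy, hX]
      push_cast
      ring_nf
      rw [Complex.I_sq]
      ring⟩
  · exact ⟨N, L, MvPolynomial.C (M : ℂ) * (1 + ∑ i, MvPolynomial.X i ^ 2) ^ d, T, fun z => by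
      change (((R z * G z : ℝ) : ℂ)) = _
      rw [map_mul, MvPolynomial.eval_C, eval_one_add_sum_sq_pow]
      simp only [hR, hG, hy, hX]
      push_cast
      ring⟩
  -- the identity `Φ = Φ₁ - Φ₂ + i (Φ₃ - Φ₄)`
  · intro z
    rw [hΦz z]
    apply Complex.ext
    · simp
      ring
    · simp
      ring
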